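import Summits.CriticalPhenomena.PercolationContinuityZ3.Theorems.PercNearOneGluingNoHeavyLowerTailSahiGridPatternHarris
import Summits.CriticalPhenomena.PercolationContinuityZ3.Theorems.PercNearOneGluingNoHeavyLowerTailSahiGridPatternKleitman

/-!
# `NoHeavyLowerTail` (crux stmt-CriticalPhenomena-4575), Sahi programme: **TOP-SLICE DOMINANCE FOR TWO-LAYER TRIPLES, EVERY DIMENSION**

Support file (seat `prim-ineq-gen-4`, generation 11; `--supports stmt-CriticalPhenomena-4575`).  Pure proofs, no definitions, no `sorry`,
standard axioms.

THE MATHEMATICS.  Slice an up-set `A ⊆ [3]^{n+1}` along the last axis: `A_i = {q : snoc q i ∈ A}`, `A₀ ⊆ A₁ ⊆ A₂`.  Call the triple `(A,B,C)`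
TWO-LAYER if the bottom slices `A₀, B₀, C₀` are empty.  THEOREM (`two_mul_sStarD_top_le_of_twoLayer`): for two-layer up-set triples,
  `2 · sStarD A₂ B₂ C₂ ≤ sStarD A B C`
— the factor-2 top-slice dominance (TOP) of the gen-11 memo (`run/shared/lean/prim/prim-ineq-gen-4/FINDING-TOP-SLICE-DOMINANCE-g11.md` §2c),
in every dimension.  (TOP in this generality is the hypothesis of `patternPos_of_topSlice_succ`; it is FALSE for general three-layer triples from
`n+1 = 5` on, but true here.)  Proof = the memo's ten lines: the counting form of `sStarD` (`sStarD_counting`: `2^{m+1}D − N_A − N_B − N_C + L`),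
the two-layer value (`sStarD_twoLayer`: `4·2^n(D(u,v,w)+D(U,V,W)) − Σ N(x;Y,Z) − Σ N(X;y,z)`), fibre Kleitman (`sum_ind_lat_le_td`, twice),
coefficientwise Harris (`sum_ind_totDist_le`, three times) and the bilinear slack `N(U;V,W) − N(u;V,W) − N(U;v,w) + N(u;v,w) ≥ 0`. [this work]
-/

namespace Summit.CriticalPhenomena.PercolationContinuityZ3.Theorems.SahiGridPattern

open Finset SahiGrid3
open scoped BigOperators

variable {m n : ℕ}

/-! ### Bookkeeping: finset sums as indicator sums, collapsing Kronecker deltas -/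

/-- A sum over a finset as an indicator-weighted sum over the whole cube. [this work] -/
theorem sum_mem_eq_sum_ind (S : Finset (Pd m)) (f : Pd m → ℤ) : (∑ x ∈ S, f x) = ∑ x, ind S x * f x := by
  unfold ind
  rw [← Finset.sum_filter_add_sum_filter_not univ (· ∈ S)]
  rw [Finset.filter_mem_eq_inter, Finset.univ_inter]
  have h0 : (∑ x ∈ univ.filter (fun x => ¬ x ∈ S), (if x ∈ S then (1:ℤ) else 0) * f x) = 0 :=
    Finset.sum_eq_zero fun x hx => by rw [mem_filter] at hx; rw [if_neg hx.2]; ring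
  rw [h0, add_zero]
  exact Finset.sum_congr rfl fun x hx => by rw [if_pos hx]; ring

/-- `sStarD` as a triple indicator sum against the tensor. [this work] -/
theorem sStarD_eq_sum_ind (X Y Z : Finset (Pd m)) :
    sStarD X Y Z = ∑ p, ∑ q, ∑ r, ind X p * ind Y q * ind Z r * tcD p q r := by
  rw [sStarD_eq_sum_tcD, sum_mem_eq_sum_ind]
  refine Finset.sum_congr rfl fun p _ => ?_
  rw [sum_mem_eq_sum_ind, Finset.mul_sum]
  refine Finset.sum_congr rfl fun q _ => ?_
  rw [sum_mem_eq_sum_ind, Finset.mul_sum, Finset.mul_sum]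
  refine Finset.sum_congr rfl fun r _ => ?_
  ring

/-- Collapsing `[q = r]`. [this work] -/
theorem sum_mul_ite_eq (q : Pd m) (g : Pd m → ℤ) : (∑ r, g r * (if q = r then (1:ℤ) else 0)) = g q := by
  rw [Finset.sum_mul_boole]; simp

/-- Collapsing `[r = q]`. [this work] -/
theorem sum_mul_ite_eq' (q : Pd m) (g : Pd m → ℤ) : (∑ r, g r * (if r = q then (1:ℤ) else 0)) = g q := by
  have : ∀ r, (g r * (if r = q then (1:ℤ) else 0)) = g r * (if q = r then (1:ℤ) else 0) := by
    intro r; by_cases h : r = q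
    · rw [if_pos h, if_pos h.symm]
    · rw [if_neg h, if_neg (fun h' => h h'.symm)]
  rw [Finset.sum_congr rfl fun r _ => this r, sum_mul_ite_eq]

/-- Splitting a conjunction indicator. [this work] -/
theorem ite_and_eq_mul (P Q : Prop) [Decidable P] [Decidable Q] : (if (P ∧ Q) then (1:ℤ) else 0) = (if P then 1 else 0) * (if Q then 1 else 0) := by
  split_ifs <;> simp_all

/-! ### The counting form of `sStarD` (every dimension) -/

/-- **Counting form**: `sStarD X Y Z = 2^{m+1}·D − N(X;Y,Z) − N(Y;X,Z) − N(Z;X,Y) + L(X;Y,Z)` with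
`D = Σ_p 1_X1_Y1_Z`, `N(X;Y,Z) = Σ_{p δ̸ q} 1_X(p)1_Y(q)1_Z(q)`, `L(X;Y,Z) = Σ_{q δ̸ r} 1_Y(q)1_Z(r)1_X(q̄r)`. [this work] -/
theorem sStarD_counting (X Y Z : Finset (Pd m)) :
    sStarD X Y Z = 2 * 2 ^ m * (∑ p, ind X p * ind Y p * ind Z p)
      - (∑ p, ∑ q, ind X p * ind Y q * ind Z q * (if TotDist p q = true then (1:ℤ) else 0))
      - (∑ p, ∑ q, ind Y p * ind X q * ind Z q * (if TotDist p q = true then (1:ℤ) else 0))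
      - (∑ p, ∑ q, ind Z p * ind X q * ind Y q * (if TotDist p q = true then (1:ℤ) else 0))
      + (∑ q, ∑ r, ind Y q * ind Z r * ind X (thirdPt q r) * (if TotDist q r = true then (1:ℤ) else 0)) := by
  rw [sStarD_eq_sum_ind]
  -- expand the tensor
  have hexp : ∀ p q r : Pd m, ind X p * ind Y q * ind Z r * tcD p q r =
      2 * 2 ^ m * (ind X p * ind Y q * ind Z r * ((if p = q then (1:ℤ) else 0) * (if q = r then (1:ℤ) else 0)))
      - ind X p * ind Y q * ind Z r * ((if TotDist p q = true then (1:ℤ) else 0) * (if q = r then (1:ℤ) else 0))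
      - ind X p * ind Y q * ind Z r * ((if TotDist q p = true then (1:ℤ) else 0) * (if p = r then (1:ℤ) else 0))
      - ind X p * ind Y q * ind Z r * ((if TotDist r p = true then (1:ℤ) else 0) * (if p = q then (1:ℤ) else 0))
      + ind X p * ind Y q * ind Z r * ((if TotDist q r = true then (1:ℤ) else 0) * (if p = thirdPt q r then (1:ℤ) else 0)) := by
    intro p q r
    rw [tcD_eq_ite, ← ite_and_eq_mul, ← ite_and_eq_mul, ← ite_and_eq_mul, ← ite_and_eq_mul, ← ite_and_eq_mul]
    have e1 : (if (p = q ∧ q = r) then (2:ℤ) ^ m else 0) = 2 ^ m * (if (p = q ∧ q = r) then (1:ℤ) else 0) := by split_ifs <;> ring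
    rw [e1]; ring
  simp only [hexp, Finset.sum_add_distrib, Finset.sum_sub_distrib, ← Finset.mul_sum]
  -- collapse the five terms
  have t1 : (∑ p, ∑ q, ∑ r, ind X p * ind Y q * ind Z r * ((if p = q then (1:ℤ) else 0) * (if q = r then (1:ℤ) else 0))) =
      ∑ p, ind X p * ind Y p * ind Z p := by
    refine Finset.sum_congr rfl fun p _ => ?_
    have inner : ∀ q, (∑ r, ind X p * ind Y q * ind Z r * ((if p = q then (1:ℤ) else 0) * (if q = r then (1:ℤ) else 0))) =
        (ind X p * ind Y q * ind Z q) * (if p = q then (1:ℤ) else 0) := by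
      intro q
      have : ∀ r, ind X p * ind Y q * ind Z r * ((if p = q then (1:ℤ) else 0) * (if q = r then (1:ℤ) else 0)) =
          (ind X p * ind Y q * (if p = q then (1:ℤ) else 0) * ind Z r) * (if q = r then (1:ℤ) else 0) := by intro r; ring
      rw [Finset.sum_congr rfl fun r _ => this r, sum_mul_ite_eq]; ring
    rw [Finset.sum_congr rfl fun q _ => inner q, sum_mul_ite_eq]
  have t2 : (∑ p, ∑ q, ∑ r, ind X p * ind Y q * ind Z r * ((if TotDist p q = true then (1:ℤ) else 0) * (if q = r then (1:ℤ) else 0))) =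
      ∑ p, ∑ q, ind X p * ind Y q * ind Z q * (if TotDist p q = true then (1:ℤ) else 0) := by
    refine Finset.sum_congr rfl fun p _ => Finset.sum_congr rfl fun q _ => ?_
    have : ∀ r, ind X p * ind Y q * ind Z r * ((if TotDist p q = true then (1:ℤ) else 0) * (if q = r then (1:ℤ) else 0)) =
        (ind X p * ind Y q * (if TotDist p q = true then (1:ℤ) else 0) * ind Z r) * (if q = r then (1:ℤ) else 0) := by intro r; ring
    rw [Finset.sum_congr rfl fun r _ => this r, sum_mul_ite_eq]; ring
  have t3 : (∑ p, ∑ q, ∑ r, ind X p * ind Y q * ind Z r * ((if TotDist q p = true then (1:ℤ) else 0) * (if p = r then (1:ℤ) else 0))) =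
      ∑ p, ∑ q, ind Y p * ind X q * ind Z q * (if TotDist p q = true then (1:ℤ) else 0) := by
    rw [Finset.sum_comm]
    refine Finset.sum_congr rfl fun q _ => Finset.sum_congr rfl fun p _ => ?_
    have : ∀ r, ind X p * ind Y q * ind Z r * ((if TotDist q p = true then (1:ℤ) else 0) * (if p = r then (1:ℤ) else 0)) =
        (ind X p * ind Y q * (if TotDist q p = true then (1:ℤ) else 0) * ind Z r) * (if p = r then (1:ℤ) else 0) := by intro r; ring
    rw [Finset.sum_congr rfl fun r _ => this r, sum_mul_ite_eq]; ring
  have t4 : (∑ p, ∑ q, ∑ r, ind X p * ind Y q * ind Z r * ((if TotDist r p = true then (1:ℤ) else 0) * (if p = q then (1:ℤ) else 0))) =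
      ∑ p, ∑ q, ind Z p * ind X q * ind Y q * (if TotDist p q = true then (1:ℤ) else 0) := by
    -- collapse q (= p) first, then rename (p,r) -> (q,p)
    have step : (∑ p, ∑ q, ∑ r, ind X p * ind Y q * ind Z r * ((if TotDist r p = true then (1:ℤ) else 0) * (if p = q then (1:ℤ) else 0))) =
        ∑ p, ∑ r, ind X p * ind Y p * ind Z r * (if TotDist r p = true then (1:ℤ) else 0) := by
      refine Finset.sum_congr rfl fun p _ => ?_
      rw [Finset.sum_comm]
      refine Finset.sum_congr rfl fun r _ => ?_
      have : ∀ q, ind X p * ind Y q * ind Z r * ((if TotDist r p = true then (1:ℤ) else 0) * (if p = q then (1:ℤ) else 0)) =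
          (ind X p * ind Z r * (if TotDist r p = true then (1:ℤ) else 0) * ind Y q) * (if p = q then (1:ℤ) else 0) := by intro q; ring
      rw [Finset.sum_congr rfl fun q _ => this q, sum_mul_ite_eq]; ring
    rw [step, Finset.sum_comm]
    refine Finset.sum_congr rfl fun r _ => Finset.sum_congr rfl fun p _ => ?_
    ring
  have t5 : (∑ p, ∑ q, ∑ r, ind X p * ind Y q * ind Z r * ((if TotDist q r = true then (1:ℤ) else 0) * (if p = thirdPt q r then (1:ℤ) else 0))) =
      ∑ q, ∑ r, ind Y q * ind Z r * ind X (thirdPt q r) * (if TotDist q r = true then (1:ℤ) else 0) := by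
    rw [Finset.sum_comm]
    refine Finset.sum_congr rfl fun q _ => ?_
    rw [Finset.sum_comm]
    refine Finset.sum_congr rfl fun r _ => ?_
    have : ∀ p, ind X p * ind Y q * ind Z r * ((if TotDist q r = true then (1:ℤ) else 0) * (if p = thirdPt q r then (1:ℤ) else 0)) =
        (ind Y q * ind Z r * (if TotDist q r = true then (1:ℤ) else 0) * ind X p) * (if p = thirdPt q r then (1:ℤ) else 0) := by intro p; ring
    rw [Finset.sum_congr rfl fun p _ => this p, sum_mul_ite_eq']; ring
  rw [t1, t2, t3, t4, t5]


/-! ### Collapsed forms of the five axis-product sums -/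

/-- Diagonal collapse: `Σ_{p,q,r} 1_X(p)1_Y(q)1_Z(r)·∏c1 = 2^m Σ_p 1_X1_Y1_Z`. [this work] -/
theorem sum3_prod_c1 (X Y Z : Finset (Pd m)) :
    (∑ p, ∑ q, ∑ r, ind X p * ind Y q * ind Z r * ∏ a, c1 (p a) (q a) (r a)) = 2 ^ m * ∑ p, ind X p * ind Y p * ind Z p := by
  simp_rw [prod_c1_eq]
  rw [Finset.mul_sum]
  refine Finset.sum_congr rfl fun p _ => ?_
  have inner : ∀ q, (∑ r, ind X p * ind Y q * ind Z r * (if (p = q ∧ q = r) then (2:ℤ) ^ m else 0)) =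
      (2 ^ m * (ind X p * ind Y q * ind Z q)) * (if p = q then (1:ℤ) else 0) := by
    intro q
    have : ∀ r, ind X p * ind Y q * ind Z r * (if (p = q ∧ q = r) then (2:ℤ) ^ m else 0) =
        (2 ^ m * ind X p * ind Y q * (if p = q then (1:ℤ) else 0) * ind Z r) * (if q = r then (1:ℤ) else 0) := by
      intro r; rw [show (if (p = q ∧ q = r) then (2:ℤ) ^ m else 0) = 2 ^ m * (if (p = q ∧ q = r) then (1:ℤ) else 0) by split_ifs <;> ring,
        ite_and_eq_mul]; ring
    rw [Finset.sum_congr rfl fun r _ => this r, sum_mul_ite_eq]; ring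
  rw [Finset.sum_congr rfl fun q _ => inner q, sum_mul_ite_eq]

/-- Pair collapse, first orientation: `∏ c2(p,q,r) = [p δ̸ q ∧ q = r]`. [this work] -/
theorem sum3_prod_c2 (X Y Z : Finset (Pd m)) :
    (∑ p, ∑ q, ∑ r, ind X p * ind Y q * ind Z r * ∏ a, c2 (p a) (q a) (r a)) =
      ∑ p, ∑ q, ind X p * ind Y q * ind Z q * (if TotDist p q = true then (1:ℤ) else 0) := by
  simp_rw [prod_c2_eq]
  refine Finset.sum_congr rfl fun p _ => Finset.sum_congr rfl fun q _ => ?_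
  have : ∀ r, ind X p * ind Y q * ind Z r * (if (TotDist p q = true ∧ q = r) then (1:ℤ) else 0) =
      (ind X p * ind Y q * (if TotDist p q = true then (1:ℤ) else 0) * ind Z r) * (if q = r then (1:ℤ) else 0) := by
    intro r; rw [ite_and_eq_mul]; ring
  rw [Finset.sum_congr rfl fun r _ => this r, sum_mul_ite_eq]; ring

/-- Pair collapse, second orientation: `∏ c2(q,p,r) = [q δ̸ p ∧ p = r]`. [this work] -/
theorem sum3_prod_c2' (X Y Z : Finset (Pd m)) :
    (∑ p, ∑ q, ∑ r, ind X p * ind Y q * ind Z r * ∏ a, c2 (q a) (p a) (r a)) =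
      ∑ p, ∑ q, ind Y p * ind X q * ind Z q * (if TotDist p q = true then (1:ℤ) else 0) := by
  simp_rw [prod_c2_eq]
  rw [Finset.sum_comm]
  refine Finset.sum_congr rfl fun q _ => Finset.sum_congr rfl fun p _ => ?_
  have : ∀ r, ind X p * ind Y q * ind Z r * (if (TotDist q p = true ∧ p = r) then (1:ℤ) else 0) =
      (ind X p * ind Y q * (if TotDist q p = true then (1:ℤ) else 0) * ind Z r) * (if p = r then (1:ℤ) else 0) := by
    intro r; rw [ite_and_eq_mul]; ring
  rw [Finset.sum_congr rfl fun r _ => this r, sum_mul_ite_eq]; ring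

/-- Pair collapse, third orientation: `∏ c2(r,p,q) = [r δ̸ p ∧ p = q]`. [this work] -/
theorem sum3_prod_c2'' (X Y Z : Finset (Pd m)) :
    (∑ p, ∑ q, ∑ r, ind X p * ind Y q * ind Z r * ∏ a, c2 (r a) (p a) (q a)) =
      ∑ p, ∑ q, ind Z p * ind X q * ind Y q * (if TotDist p q = true then (1:ℤ) else 0) := by
  simp_rw [prod_c2_eq]
  have step : (∑ p, ∑ q, ∑ r, ind X p * ind Y q * ind Z r * (if (TotDist r p = true ∧ p = q) then (1:ℤ) else 0)) =
      ∑ p, ∑ r, ind X p * ind Y p * ind Z r * (if TotDist r p = true then (1:ℤ) else 0) := by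
    refine Finset.sum_congr rfl fun p _ => ?_
    rw [Finset.sum_comm]
    refine Finset.sum_congr rfl fun r _ => ?_
    have : ∀ q, ind X p * ind Y q * ind Z r * (if (TotDist r p = true ∧ p = q) then (1:ℤ) else 0) =
        (ind X p * ind Z r * (if TotDist r p = true then (1:ℤ) else 0) * ind Y q) * (if p = q then (1:ℤ) else 0) := by
      intro q; rw [ite_and_eq_mul]; ring
    rw [Finset.sum_congr rfl fun q _ => this q, sum_mul_ite_eq]; ring
  rw [step, Finset.sum_comm]
  refine Finset.sum_congr rfl fun r _ => Finset.sum_congr rfl fun p _ => ?_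
  ring

/-- Latin collapse: `∏ c3 = [q δ̸ r ∧ p = q̄r]`. [this work] -/
theorem sum3_prod_c3 (X Y Z : Finset (Pd m)) :
    (∑ p, ∑ q, ∑ r, ind X p * ind Y q * ind Z r * ∏ a, c3 (p a) (q a) (r a)) =
      ∑ q, ∑ r, ind Y q * ind Z r * ind X (thirdPt q r) * (if TotDist q r = true then (1:ℤ) else 0) := by
  simp_rw [prod_c3_eq]
  rw [Finset.sum_comm]
  refine Finset.sum_congr rfl fun q _ => ?_
  rw [Finset.sum_comm]
  refine Finset.sum_congr rfl fun r _ => ?_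
  have : ∀ p, ind X p * ind Y q * ind Z r * (if (TotDist q r = true ∧ p = thirdPt q r) then (1:ℤ) else 0) =
      (ind Y q * ind Z r * (if TotDist q r = true then (1:ℤ) else 0) * ind X p) * (if p = thirdPt q r then (1:ℤ) else 0) := by
    intro p; rw [ite_and_eq_mul]; ring
  rw [Finset.sum_congr rfl fun p _ => this p, sum_mul_ite_eq']; ring

/-- **One level block of the slice expansion**: for finsets `S, T, R ⊆ [3]^n` and levels `i, j, k`,
`Σ_{p,q,r} 1_S(p)1_T(q)1_R(r)·t_{n+1}(snoc p i, snoc q j, snoc r k)` in collapsed form. [this work] -/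
theorem block_eq (S T R : Finset (Pd n)) (i j k : Fin 3) :
    (∑ p, ∑ q, ∑ r, ind S p * ind T q * ind R r * tcD (Fin.snoc p i : Pd (n + 1)) (Fin.snoc q j) (Fin.snoc r k)) =
      c1 i j k * (2 * 2 ^ n * ∑ p, ind S p * ind T p * ind R p)
      - c2 i j k * (∑ p, ∑ q, ind S p * ind T q * ind R q * (if TotDist p q = true then (1:ℤ) else 0))
      - c2 j i k * (∑ p, ∑ q, ind T p * ind S q * ind R q * (if TotDist p q = true then (1:ℤ) else 0))
      - c2 k i j * (∑ p, ∑ q, ind R p * ind S q * ind T q * (if TotDist p q = true then (1:ℤ) else 0))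
      + c3 i j k * (∑ q, ∑ r, ind T q * ind R r * ind S (thirdPt q r) * (if TotDist q r = true then (1:ℤ) else 0)) := by
  have h : ∀ p q r : Pd n, ind S p * ind T q * ind R r * tcD (Fin.snoc p i : Pd (n + 1)) (Fin.snoc q j) (Fin.snoc r k) =
      (2 * c1 i j k) * (ind S p * ind T q * ind R r * ∏ a, c1 (p a) (q a) (r a))
      - c2 i j k * (ind S p * ind T q * ind R r * ∏ a, c2 (p a) (q a) (r a))
      - c2 j i k * (ind S p * ind T q * ind R r * ∏ a, c2 (q a) (p a) (r a))
      - c2 k i j * (ind S p * ind T q * ind R r * ∏ a, c2 (r a) (p a) (q a))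
      + c3 i j k * (ind S p * ind T q * ind R r * ∏ a, c3 (p a) (q a) (r a)) := by
    intro p q r; rw [tcD_snoc]; ring
  simp only [h, Finset.sum_add_distrib, Finset.sum_sub_distrib, ← Finset.mul_sum]
  rw [sum3_prod_c1, sum3_prod_c2, sum3_prod_c2', sum3_prod_c2'', sum3_prod_c3]
  ring


/-! ### The theorem -/

/-- Values of the per-axis counts on the two upper levels `1, 2` (bookkeeping). [this work] -/
theorem c_vals_upper :
    c1 (1:Fin 3) 1 1 = 2 ∧ c1 (2:Fin 3) 2 2 = 2 ∧ c1 (1:Fin 3) 1 2 = 0 ∧ c1 (1:Fin 3) 2 1 = 0 ∧ c1 (2:Fin 3) 1 1 = 0 ∧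
    c1 (1:Fin 3) 2 2 = 0 ∧ c1 (2:Fin 3) 1 2 = 0 ∧ c1 (2:Fin 3) 2 1 = 0 ∧
    c2 (1:Fin 3) 2 2 = 1 ∧ c2 (2:Fin 3) 1 1 = 1 ∧ c2 (1:Fin 3) 1 1 = 0 ∧ c2 (2:Fin 3) 2 2 = 0 ∧ c2 (1:Fin 3) 1 2 = 0 ∧
    c2 (1:Fin 3) 2 1 = 0 ∧ c2 (2:Fin 3) 1 2 = 0 ∧ c2 (2:Fin 3) 2 1 = 0 ∧
    c3 (1:Fin 3) 1 1 = 0 ∧ c3 (2:Fin 3) 2 2 = 0 ∧ c3 (1:Fin 3) 1 2 = 0 ∧ c3 (1:Fin 3) 2 1 = 0 ∧ c3 (2:Fin 3) 1 1 = 0 ∧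
    c3 (1:Fin 3) 2 2 = 0 ∧ c3 (2:Fin 3) 1 2 = 0 ∧ c3 (2:Fin 3) 2 1 = 0 := by
  unfold c1 c2 c3; decide

/-- The bilinear slack of a nested pair of families is nonnegative:
`N(U;V,W) − N(u;V,W) − N(U;v,w) + N(u;v,w) = Σ (1_U − 1_u)(1_V1_W − 1_v1_w)[δ̸] ≥ 0` for `u ⊆ U`, `v ⊆ V`, `w ⊆ W` (indicatorwise). [this work] -/
theorem nested_slack_nonneg {u U v V w W : Finset (Pd m)} (hu : ∀ p, ind u p ≤ ind U p) (hv : ∀ p, ind v p ≤ ind V p)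
    (hw : ∀ p, ind w p ≤ ind W p) :
    0 ≤ (∑ p, ∑ q, ind U p * ind V q * ind W q * (if TotDist p q = true then (1:ℤ) else 0))
      - (∑ p, ∑ q, ind u p * ind V q * ind W q * (if TotDist p q = true then (1:ℤ) else 0))
      - (∑ p, ∑ q, ind U p * ind v q * ind w q * (if TotDist p q = true then (1:ℤ) else 0))
      + (∑ p, ∑ q, ind u p * ind v q * ind w q * (if TotDist p q = true then (1:ℤ) else 0)) := by
  have e : (∑ p, ∑ q, ind U p * ind V q * ind W q * (if TotDist p q = true then (1:ℤ) else 0))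
      - (∑ p, ∑ q, ind u p * ind V q * ind W q * (if TotDist p q = true then (1:ℤ) else 0))
      - (∑ p, ∑ q, ind U p * ind v q * ind w q * (if TotDist p q = true then (1:ℤ) else 0))
      + (∑ p, ∑ q, ind u p * ind v q * ind w q * (if TotDist p q = true then (1:ℤ) else 0)) =
      ∑ p, ∑ q, (ind U p - ind u p) * (ind V q * ind W q - ind v q * ind w q) * (if TotDist p q = true then (1:ℤ) else 0) := by
    simp only [← Finset.sum_sub_distrib, ← Finset.sum_add_distrib]
    refine Finset.sum_congr rfl fun p _ => Finset.sum_congr rfl fun q _ => ?_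
    ring
  rw [e]
  refine Finset.sum_nonneg fun p _ => Finset.sum_nonneg fun q _ => ?_
  have h1 : 0 ≤ ind U p - ind u p := by linarith [hu p]
  have h2 : 0 ≤ ind V q * ind W q - ind v q * ind w q := by
    have := mul_le_mul (hv q) (hw q) (ind_nonneg' w q) (ind_nonneg' V q)
    linarith
  have h3 : (0:ℤ) ≤ (if TotDist p q = true then (1:ℤ) else 0) := by split_ifs <;> norm_num
  exact mul_nonneg (mul_nonneg h1 h2) h3

/-- Coefficientwise Harris for a triple product: `N(u;v,w) ≤ 2^m Σ 1_u1_v1_w`. [this work] -/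
theorem sum_ind3_totDist_le {u v w : Finset (Pd m)} (hu : IsUpperSet (u : Set (Pd m))) (hv : IsUpperSet (v : Set (Pd m)))
    (hw : IsUpperSet (w : Set (Pd m))) :
    (∑ p, ∑ q, ind u p * ind v q * ind w q * (if TotDist p q = true then (1:ℤ) else 0)) ≤ 2 ^ m * ∑ p, ind u p * ind v p * ind w p := by
  have hvw : IsUpperSet ((v ∩ w : Finset (Pd m)) : Set (Pd m)) := by rw [Finset.coe_inter]; exact hv.inter hw
  have key := sum_ind_totDist_le m u (v ∩ w) hu hvw
  have e1 : (∑ p, ∑ q, ind u p * ind v q * ind w q * (if TotDist p q = true then (1:ℤ) else 0)) =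
      ∑ p, ∑ q, ind u p * ind (v ∩ w) q * (if TotDist p q = true then (1:ℤ) else 0) := by
    refine Finset.sum_congr rfl fun p _ => Finset.sum_congr rfl fun q _ => ?_
    rw [ind_inter_eq_mul]; ring
  have e2 : (∑ p, ind u p * ind v p * ind w p) = ∑ p, ind u p * ind (v ∩ w) p := by
    refine Finset.sum_congr rfl fun p _ => ?_
    rw [ind_inter_eq_mul]; ring
  rw [e1, e2]; exact key

/-- **TOP-SLICE DOMINANCE FOR TWO-LAYER TRIPLES** (every `n`): if the up-sets `A, B, C ⊆ [3]^{n+1}` contain no point on the bottom level of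
the last axis, then `2 · sStarD A₂ B₂ C₂ ≤ sStarD A B C` (`A₂ = {q : snoc q 2 ∈ A}` the top slice). [this work] -/
theorem two_mul_sStarD_top_le_of_twoLayer (A B C : Finset (Pd (n + 1)))
    (hA : IsUpperSet (A : Set (Pd (n + 1)))) (hB : IsUpperSet (B : Set (Pd (n + 1)))) (hC : IsUpperSet (C : Set (Pd (n + 1))))
    (hA0 : ∀ q : Pd n, (Fin.snoc q 0 : Pd (n + 1)) ∉ A) (hB0 : ∀ q : Pd n, (Fin.snoc q 0 : Pd (n + 1)) ∉ B)
    (hC0 : ∀ q : Pd n, (Fin.snoc q 0 : Pd (n + 1)) ∉ C) :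
    2 * sStarD (univ.filter fun q : Pd n => (Fin.snoc q 2 : Pd (n + 1)) ∈ A)
          (univ.filter fun q : Pd n => (Fin.snoc q 2 : Pd (n + 1)) ∈ B)
          (univ.filter fun q : Pd n => (Fin.snoc q 2 : Pd (n + 1)) ∈ C) ≤ sStarD A B C := by
  -- the slices
  set U : Finset (Pd n) := univ.filter fun q : Pd n => (Fin.snoc q 2 : Pd (n + 1)) ∈ A with hUdef
  set V : Finset (Pd n) := univ.filter fun q : Pd n => (Fin.snoc q 2 : Pd (n + 1)) ∈ B with hVdef
  set W : Finset (Pd n) := univ.filter fun q : Pd n => (Fin.snoc q 2 : Pd (n + 1)) ∈ C with hWdef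
  set u : Finset (Pd n) := univ.filter fun q : Pd n => (Fin.snoc q 1 : Pd (n + 1)) ∈ A with hudef
  set v : Finset (Pd n) := univ.filter fun q : Pd n => (Fin.snoc q 1 : Pd (n + 1)) ∈ B with hvdef
  set w : Finset (Pd n) := univ.filter fun q : Pd n => (Fin.snoc q 1 : Pd (n + 1)) ∈ C with hwdef
  have iU : ∀ p, ind A (Fin.snoc p 2) = ind U p := fun p => by rw [hUdef, ind_filter_snoc]
  have iV : ∀ p, ind B (Fin.snoc p 2) = ind V p := fun p => by rw [hVdef, ind_filter_snoc]
  have iW : ∀ p, ind C (Fin.snoc p 2) = ind W p := fun p => by rw [hWdef, ind_filter_snoc]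
  have iu : ∀ p, ind A (Fin.snoc p 1) = ind u p := fun p => by rw [hudef, ind_filter_snoc]
  have iv : ∀ p, ind B (Fin.snoc p 1) = ind v p := fun p => by rw [hvdef, ind_filter_snoc]
  have iw : ∀ p, ind C (Fin.snoc p 1) = ind w p := fun p => by rw [hwdef, ind_filter_snoc]
  have iA0 : ∀ p, ind A (Fin.snoc p 0) = 0 := fun p => by unfold ind; rw [if_neg (hA0 p)]
  have iB0 : ∀ p, ind B (Fin.snoc p 0) = 0 := fun p => by unfold ind; rw [if_neg (hB0 p)]
  have iC0 : ∀ p, ind C (Fin.snoc p 0) = 0 := fun p => by unfold ind; rw [if_neg (hC0 p)]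
  -- up-set and nesting facts
  have hUup : IsUpperSet (U : Set (Pd n)) := by rw [hUdef]; exact isUpperSet_filter_snoc hA 2
  have hVup : IsUpperSet (V : Set (Pd n)) := by rw [hVdef]; exact isUpperSet_filter_snoc hB 2
  have hWup : IsUpperSet (W : Set (Pd n)) := by rw [hWdef]; exact isUpperSet_filter_snoc hC 2
  have huup : IsUpperSet (u : Set (Pd n)) := by rw [hudef]; exact isUpperSet_filter_snoc hA 1
  have hvup : IsUpperSet (v : Set (Pd n)) := by rw [hvdef]; exact isUpperSet_filter_snoc hB 1
  have hwup : IsUpperSet (w : Set (Pd n)) := by rw [hwdef]; exact isUpperSet_filter_snoc hC 1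
  have nu : ∀ p, ind u p ≤ ind U p := fun p => by rw [← iu, ← iU]; exact ind_snoc_mono hA p (by decide)
  have nv : ∀ p, ind v p ≤ ind V p := fun p => by rw [← iv, ← iV]; exact ind_snoc_mono hB p (by decide)
  have nw : ∀ p, ind w p ≤ ind W p := fun p => by rw [← iw, ← iW]; exact ind_snoc_mono hC p (by decide)
  -- the value of sStarD A B C (two-layer expansion)
  have eA : sStarD A B C = 4 * 2 ^ n * (∑ p, ind u p * ind v p * ind w p) + 4 * 2 ^ n * (∑ p, ind U p * ind V p * ind W p)
      - (∑ p, ∑ q, ind u p * ind V q * ind W q * (if TotDist p q = true then (1:ℤ) else 0))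
      - (∑ p, ∑ q, ind U p * ind v q * ind w q * (if TotDist p q = true then (1:ℤ) else 0))
      - (∑ p, ∑ q, ind v p * ind U q * ind W q * (if TotDist p q = true then (1:ℤ) else 0))
      - (∑ p, ∑ q, ind V p * ind u q * ind w q * (if TotDist p q = true then (1:ℤ) else 0))
      - (∑ p, ∑ q, ind w p * ind U q * ind V q * (if TotDist p q = true then (1:ℤ) else 0))
      - (∑ p, ∑ q, ind W p * ind u q * ind v q * (if TotDist p q = true then (1:ℤ) else 0)) := by
    rw [sStarD_eq_sum_ind]
    simp only [sum_snoc, Fin.sum_univ_three, iA0, iB0, iC0, iU, iV, iW, iu, iv, iw, zero_mul, mul_zero,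
      Finset.sum_const_zero, zero_add, Finset.sum_add_distrib]
    rw [block_eq, block_eq, block_eq, block_eq, block_eq, block_eq, block_eq, block_eq]
    obtain ⟨a1, a2, a3, a4, a5, a6, a7, a8, b1, b2, b3, b4, b5, b6, b7, b8, d1, d2, d3, d4, d5, d6, d7, d8⟩ := c_vals_upper
    rw [a1, a2, a3, a4, a5, a6, a7, a8, b1, b2, b3, b4, b5, b6, b7, b8, d1, d2, d3, d4, d5, d6, d7, d8]
    ring
  -- the counting form of the top functional
  have eT := sStarD_counting U V W
  -- fibre Kleitman, twice
  have K1 := sum_ind_lat_le_td V hWup hUup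
  have K1' : (∑ q, ∑ r, ind V q * ind W r * ind U (thirdPt q r) * (if TotDist q r = true then (1:ℤ) else 0)) ≤
      ∑ p, ∑ q, ind V p * ind U q * ind W q * (if TotDist p q = true then (1:ℤ) else 0) := by
    refine le_trans K1 (le_of_eq ?_)
    refine Finset.sum_congr rfl fun p _ => Finset.sum_congr rfl fun q _ => ?_
    ring
  have K2 := sum_ind_lat_le_td W hVup hUup
  have K2' : (∑ q, ∑ r, ind V q * ind W r * ind U (thirdPt q r) * (if TotDist q r = true then (1:ℤ) else 0)) ≤
      ∑ p, ∑ q, ind W p * ind U q * ind V q * (if TotDist p q = true then (1:ℤ) else 0) := by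
    have e : (∑ q, ∑ r, ind V q * ind W r * ind U (thirdPt q r) * (if TotDist q r = true then (1:ℤ) else 0)) =
        ∑ p, ∑ q, ind W p * ind V q * ind U (thirdPt p q) * (if TotDist p q = true then (1:ℤ) else 0) := by
      rw [Finset.sum_comm]
      refine Finset.sum_congr rfl fun r _ => Finset.sum_congr rfl fun q _ => ?_
      rw [thirdPt_comm q r, totDist_symm q r]; ring
    rw [e]
    refine le_trans K2 (le_of_eq ?_)
    refine Finset.sum_congr rfl fun p _ => Finset.sum_congr rfl fun q _ => ?_
    ring
  -- coefficientwise Harris, three times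
  have HA := sum_ind3_totDist_le huup hvup hwup
  have HB' := sum_ind3_totDist_le hvup huup hwup
  have HB : (∑ p, ∑ q, ind v p * ind u q * ind w q * (if TotDist p q = true then (1:ℤ) else 0)) ≤
      2 ^ n * ∑ p, ind u p * ind v p * ind w p := by
    refine le_trans HB' (le_of_eq ?_); congr 1
    exact Finset.sum_congr rfl fun p _ => by ring
  have HC' := sum_ind3_totDist_le hwup huup hvup
  have HC : (∑ p, ∑ q, ind w p * ind u q * ind v q * (if TotDist p q = true then (1:ℤ) else 0)) ≤
      2 ^ n * ∑ p, ind u p * ind v p * ind w p := by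
    refine le_trans HC' (le_of_eq ?_); congr 1
    exact Finset.sum_congr rfl fun p _ => by ring
  -- bilinear slacks
  have dA := nested_slack_nonneg (U := U) (V := V) (W := W) nu nv nw
  have dB := nested_slack_nonneg (U := V) (V := U) (W := W) nv nu nw
  have dC := nested_slack_nonneg (U := W) (V := U) (W := V) nw nu nv
  -- nonnegativity of the remaining top term and of the diagonal
  have TA : 0 ≤ ∑ p, ∑ q, ind U p * ind V q * ind W q * (if TotDist p q = true then (1:ℤ) else 0) :=
    Finset.sum_nonneg fun p _ => Finset.sum_nonneg fun q _ => mul_nonneg (mul_nonneg (mul_nonneg (ind_nonneg' U p) (ind_nonneg' V q))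
      (ind_nonneg' W q)) (by split_ifs <;> norm_num)
  have Du : 0 ≤ 2 ^ n * ∑ p, ind u p * ind v p * ind w p :=
    mul_nonneg (pow_nonneg (by norm_num) n) (Finset.sum_nonneg fun p _ => mul_nonneg (mul_nonneg (ind_nonneg' u p) (ind_nonneg' v p)) (ind_nonneg' w p))
  rw [eT, eA]
  linarith

end Summit.CriticalPhenomena.PercolationContinuityZ3.Theorems.SahiGridPattern
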